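import Mathlib
import Summits.Langlands.Langlands.Theorems.SkinnerWilesDefectOneReducibleOrdinaryProModularGrothendieckConnectedness
import Summits.Langlands.Langlands.Theorems.SkinnerWilesDefectOneReducibleOrdinaryProModularGrothendieckConnectednessReduction

/-!
# Stub (R) `stub_raynaudConnectedness` — Raynaud / Grothendieck connectedness for Cohen–Macaulay presentations, PROVED

Route `SkinnerWilesDefectOne`, crux `ReducibleOrdinaryProModular` (stmt-Langlands-12919), line
`fine-selmer-codimension-two`.  The registered stub (R) of the line's skeleton — [Skinner–Wiles 1999, App. A,
Cor. A.2] in crossing form: for `A` a complete Noetherian local ring with an `A`-regular sequence in `𝔪` of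
length `dim A`, `R ≅ A/I` and `n + 1 + μ(I) ≤ dim A`, every two-colouring of the minimal primes of `R` using both
colours has minimal primes `C₁, C₂` of different colours with `n ≤ dim R/(C₁ + C₂)` — follows from Grothendieck's
connectedness theorem SGA 2 XIII 2.1, now PROVED in the tree (`Theorems.GrothendieckConnectedness_holds`,
`…GrothendieckConnectedness.lean`), by the landed reduction `stub_raynaudConnectedness_of_grothendieckConnectedness`
(`…GrothendieckConnectednessReduction.lean`, lineage 0 seat a1).  Unconditional; axioms `propext`,
`Classical.choice`, `Quot.sound`.

References: C. Skinner, A. Wiles, Publ. Math. IHÉS 89 (1999), App. A [SkinnerWiles1999]; A. Grothendieck, SGA 2,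
Exp. XIII Thm. 2.1 [Grothendieck1968SGA2].
-/

set_option linter.dupNamespace false -- project-wide option (lakefile weak.linter.dupNamespace); `Summit.Langlands.Langlands` is the mandated namespace
set_option autoImplicit false

namespace Summit.Langlands.Langlands.Cruxes.ReducibleOrdinaryProModular.FineSelmerCodimensionTwo

/-- **Stub (R) `stub_raynaudConnectedness` of the line `fine-selmer-codimension-two`, PROVED** (registered
signature verbatim): Raynaud's connectedness theorem in the crossing form of [Skinner–Wiles 1999, Cor. A.2] for
quotients `R ≅ A/I` of complete local Cohen–Macaulay rings with `n + 1 + μ(I) ≤ dim A`, from Grothendieck's SGA 2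
XIII 2.1 (`Theorems.GrothendieckConnectedness_holds`) and Hartshorne's `c(A) ≥ dim A − 1`
(`stub_raynaudConnectedness_of_grothendieckConnectedness`). [cite: SkinnerWiles1999, App. A Cor. A.2] -/
theorem stub_raynaudConnectedness :
    ∀ (R : Type) [CommRing R] (A : Type) [CommRing A] [IsNoetherianRing A] [IsLocalRing A]
      [IsAdicComplete (IsLocalRing.maximalIdeal A) A] (rs : List A),
      (∀ r ∈ rs, r ∈ IsLocalRing.maximalIdeal A) → RingTheory.Sequence.IsRegular A rs →
      (rs.length : WithBot ℕ∞) = ringKrullDim A →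
      ∀ (I : Ideal A) (_ : R ≃+* A ⧸ I) (n : ℕ), ((n + 1 : ℕ) : WithBot ℕ∞) + I.spanFinrank ≤ ringKrullDim A →
      ∀ S : Set (PrimeSpectrum R),
        (∃ C ∈ S, C.asIdeal ∈ minimalPrimes R) → (∃ C ∉ S, C.asIdeal ∈ minimalPrimes R) →
          ∃ C₁ ∈ S, ∃ C₂ ∉ S, C₁.asIdeal ∈ minimalPrimes R ∧ C₂.asIdeal ∈ minimalPrimes R ∧
            (n : WithBot ℕ∞) ≤ ringKrullDim (R ⧸ (C₁.asIdeal ⊔ C₂.asIdeal)) :=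
  stub_raynaudConnectedness_of_grothendieckConnectedness
    Summit.Langlands.Langlands.Theorems.GrothendieckConnectedness_holds

end Summit.Langlands.Langlands.Cruxes.ReducibleOrdinaryProModular.FineSelmerCodimensionTwo
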